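import Literature.Barriers.CriticalPhenomena.SupercriticalSAWSpaceFillingEstimates
import HarnessLib

/-!
# Supercritical self-avoiding walks are space-filling (Duminil-Copin–Kozma–Yadin 2014):
# the Peierls sum — Theorem 6 for the unit disk along the printed `m`-box route (conditional)

Sixth and last file of the `m`-box (moat) route to Theorem 6 of H. Duminil-Copin, G. Kozma,
A. Yadin, *Supercritical self-avoiding walks are space-filling*, Ann. IHP Probab. Stat. 50 (2014)
315–326 (arXiv:1110.3074) for `Ω = 𝔻`. Main result:

* **`DKY2014_thm6_disk_of_facts : DKY2014_prop3 → DKY2014_prop7_claim → (Proposition 7, moat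
  form) → (boundary-layer estimate) → DKY2014_thm6_disk`** — Theorem 6 for the disk
  (`SupercriticalSAWSpaceFillingSteps.lean`) from Proposition 3 (`SupercriticalSAWPolygons.lean`,
  upstream named fact), the named fact of `SupercriticalSAWSpaceFillingBoxes.lean` (the Claim of
  the proof of Proposition 7 in moat form, proved as `DKY2014_prop7_claim_holds`) and two
  explicit hypotheses: `hA2`, the energy–entropy bound of Proposition 7 for the disk over the
  boxes with moat `g = 2` of `…Boxes.lean` ("`Z_{Θ_F}(x) · Z_F(x) ≤ C(x,m) Z_{(Ω_δ,a_δ,b_δ)}(x)`",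
  per touched neighbouring box), and `hC`, covering the case the print omits (the walk meets no
  deep box). Neither is vendored as a named fact (D-0026): `hC` is not a statement of the
  source; `hA2` is the moat form of Proposition 7, whose printed proof rests on "One can easily
  check that such a polygon [the link `ℓ(γ)`] always exists" — in the moat geometry a case
  analysis of its own that nothing else in the tree consumes. Both are exactly what the tile
  form of the proof establishes in its own geometry (`mainEvent_bound` of `…TilesSurgery.lean`,
  the link realised by the `ℓ¹`-sphere templates of
  `Literature/Probability/RandomPlanarGeometry/SAWSphereCover.lean`; `annEvent_bound`,
  `annSum_le_exp` of `…TilesAnnulus.lean` / `…TilesTheorem6.lean`). The UNCONDITIONAL Theorem 6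
  for the disk is `DKY2014_thm6_disk_holds` (`SupercriticalSAWSpaceFillingTilesTheorem6.lean`);
  this file keeps the printed box route as a conditional reduction.

The printed paragraph being formalised (§3, "Theorem 6 in dimension 2"): "Let therefore
`λ = λ(2)` satisfy `A_n ≤ λⁿ` for all `n`. We now apply Proposition 3 and get some `m = m(x,2)`
such that `Z_m(x) > 2λ` … Proposition 7 implies
`P[𝒜(s)] ≤ Σ_{F ∈ 𝓕(Ω_δ,ξ) : |F| ≥ s/(2m+1)²} C(x,m) [Z_m(x)]^{-|F|}`. By the definition of `λ`,
the number of families of connected boxes of size `K` in `𝓕(Ω_δ,ξ)` is bounded by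
`(C(Ω)/δ²) λ^K` … Therefore `P[𝒜(s)] ≤ C(x,m) (C(Ω)/δ²) Σ_{i ≥ s/(2m+1)²} (λ/Z_m(x))^i ≤
(C(x,m,Ω)/δ²) 2^{-s/(2m+1)²}` and the theorem follows."

Here: `λ = 25` (`card_famAt_le`), moat `g = 2`, and `n = n(x)` with `x⁸ Z_n(x) ≥ 100` (each box
of a merged family costs `x⁸ = x^{4g}` besides `Z_n(x)`, `DKY2014_prop7_claim`), `m = n + 2`,
`ξ(x) = tubeRadius m`; the walks are split by `good_or_bad_of_hasLargeHole`
(`…Dichotomy.lean`) into those meeting no deep box (weight `≤ C_B e^{-c_B/δ²} Z` by the hypothesis `hC`,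
and `s < 25/δ²` for a nonempty event) and those in one of the events of Proposition 7 indexed
by `(z₀ ∈ deepBoxes, K, F ∈ famAt z₀ K, side)`, each of weight `≤ (C₇ x⁸/q^K) Z`, `q = x⁸ Z_n(x)`
(`weightAt_hasLargeHole_le`, a union bound in the measure `weightAt x`; the elementary estimates
— endpoints, `≤ 25/δ²` deep boxes, the geometric tail, weights to laws — are in
`…Estimates.lean`), with `c(x) = min(log 2/(7N)², c_B/25)`, `C(x) = 8 C₇ x⁸ + max(C_B, 0)`,
`δ₀(x,a,b) = min(δ_B(a,b), 1/4, 1/(3N)²)`.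
-/

noncomputable section

open MeasureTheory Literature.Probability.LatticeModels Literature.Probability.Percolation
  Literature.Probability.RandomPlanarGeometry.SAW
open scoped ENNReal

namespace Literature.Barriers.CriticalPhenomena

namespace SupercriticalSAW

variable {δ : ℝ} {u v : Site 2}

/-- **The Peierls sum (proof of Theorem 6 for the disk, given the facts).** For the box
parameter `n` (moat `g = 2`, `m = n + 2`), `q = x⁸ Z_n(x) ≥ 100`, `0 < δ ≤ min(1, 1/(3N)²)` and
`s ≥ 0`: the weight of the walks leaving a hole of `𝔻_δ ∖ Γ_δ^{ξ(m)}` larger than `s` is at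
most the weight of the walks meeting no deep box plus `(8 C₇ x⁸ / δ²) e^{-(log 2/(7N)²) s}` times
the partition function ("`P[𝒜(s)] ≤ Σ_{F : |F| ≥ s/(2m+1)²} C(x,m) Z_m(x)^{-|F|} ≤
(C(x,m,Ω)/δ²) 2^{-s/(2m+1)²}`"), where `C₇` is the constant of Proposition 7.
[cite: DuminilCopinKozmaYadin2014, §3 (proof of Theorem 6)] -/
theorem weightAt_hasLargeHole_le (hA1 : DKY2014_prop7_claim) {n : ℕ} {x : ℝ} (hx : 0 < x)
    {q : ℝ} (hq : 100 ≤ q) (hqdef : q = x ^ 8 * Zbox n x) {C₇ : ℝ} (hC₇ : 0 < C₇)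
    (hA2' : ∀ F ⊆ deepBoxes δ (n + 2), ∀ z₀ ∈ F, ∀ (i : Fin 2) (b : Bool), z₀ + dirVec i b ∉ F →
        weightAt x unitDisk δ u v {γ | (∀ w ∈ γ.walk.support, w ∉ boxVertices (n + 2) F) ∧
            ∃ w ∈ γ.walk.support, w ∈ mBox (n + 2) (z₀ + dirVec i b)} *
          ENNReal.ofReal (familyPartition n 2 F x) ≤
        ENNReal.ofReal C₇ * weightAt x unitDisk δ u v Set.univ)
    (hδ : 0 < δ) (hδ1 : δ ≤ 1) (hδ' : δ ≤ 1 / (3 * (2 * ((n + 2 : ℕ) : ℝ) + 2)) ^ 2)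
    {s : ℝ} (hs : 0 ≤ s) :
    weightAt x unitDisk δ u v {γ | HasLargeHole (tubeRadius (n + 2)) s γ} ≤
      weightAt x unitDisk δ u v
          {γ | ∀ z ∈ deepBoxes δ (n + 2), ∀ w ∈ γ.walk.support, w ∉ mBox (n + 2) z} +
        ENNReal.ofReal (8 * C₇ * x ^ 8 / δ ^ 2 *
            Real.exp (-(Real.log 2 / (7 * (2 * ((n + 2 : ℕ) : ℝ) + 2)) ^ 2 * s))) *
          weightAt x unitDisk δ u v Set.univ := by
  classical
  set W := weightAt x unitDisk δ u v with hW
  set C₃ : ℝ := (7 * (2 * ((n + 2 : ℕ) : ℝ) + 2)) ^ 2 with hC₃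
  have hC₃0 : 0 < C₃ := by positivity
  set K₀ : ℕ := ⌊s / C₃⌋₊ + 1 with hK₀
  set K₁ : ℕ := (deepBoxes δ (n + 2)).card + 1 with hK₁
  set BAD : Set (DomainSAW unitDisk δ u v) :=
    {γ | ∀ z ∈ deepBoxes δ (n + 2), ∀ w ∈ γ.walk.support, w ∉ mBox (n + 2) z} with hBAD
  set G : Finset (Site 2) → Site 2 → Fin 2 × Bool → Set (DomainSAW unitDisk δ u v) :=
    fun F z p => {γ | z + dirVec p.1 p.2 ∉ F ∧ (∀ w ∈ γ.walk.support, w ∉ boxVertices (n + 2) F) ∧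
      ∃ w ∈ γ.walk.support, w ∈ mBox (n + 2) (z + dirVec p.1 p.2)} with hG
  -- Step 1: the inclusion (geometric core)
  have hincl : {γ : DomainSAW unitDisk δ u v | HasLargeHole (tubeRadius (n + 2)) s γ} ⊆ BAD ∪
      ⋃ z ∈ deepBoxes δ (n + 2), ⋃ K ∈ Finset.Ico K₀ K₁, ⋃ F ∈ famAt δ (n + 2) z K,
        ⋃ p : Fin 2 × Bool, G F z p := by
    intro γ hγ
    rcases good_or_bad_of_hasLargeHole hδ hδ' hs hγ with hbad |
      ⟨F, hFdeep, hFconn, hFcard, hFunt, z₀, hz₀, i, b, hnot, t, ht, htmem⟩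
    · exact Or.inl hbad
    · refine Or.inr ?_
      simp only [Set.mem_iUnion]
      refine ⟨z₀, hFdeep hz₀, F.card, ?_, F, ?_, (i, b), hnot, ?_, t, ht, htmem⟩
      · rw [Finset.mem_Ico]
        constructor
        · rw [hK₀, Nat.add_one_le_iff, Nat.floor_lt (by positivity), div_lt_iff₀ hC₃0]
          rw [hC₃]; linarith
        · exact Nat.lt_succ_of_le (Finset.card_le_card hFdeep)
      · rw [mem_famAt]; exact ⟨hFdeep, hz₀, rfl, hFconn⟩
      · intro w hw hwF
        obtain ⟨z, hz, hwz⟩ := mem_boxVertices_iff.1 hwF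
        exact hFunt z hz w hw hwz
  -- Step 2: the bound on each term (Proposition 7 and the Claim)
  have hq0 : 0 < q := by linarith
  have hterm : ∀ z ∈ deepBoxes δ (n + 2), ∀ K ∈ Finset.Ico K₀ K₁, ∀ F ∈ famAt δ (n + 2) z K,
      ∀ p : Fin 2 × Bool, W (G F z p) ≤ ENNReal.ofReal (C₇ * x ^ 8 / q ^ K) * W Set.univ := by
    intro z _ K _ F hF p
    rw [mem_famAt] at hF
    obtain ⟨hFdeep, hzF, hcard, hconn⟩ := hF
    by_cases hp : z + dirVec p.1 p.2 ∈ F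
    · have : G F z p = ∅ := by
        ext γ; simp only [hG, Set.mem_setOf_eq, Set.mem_empty_iff_false, iff_false, not_and]
        exact fun h => (h hp).elim
      rw [this, measure_empty]; exact zero_le
    · have hGeq : G F z p = {γ | (∀ w ∈ γ.walk.support, w ∉ boxVertices (n + 2) F) ∧
          ∃ w ∈ γ.walk.support, w ∈ mBox (n + 2) (z + dirVec p.1 p.2)} := by
        ext γ; simp only [hG, Set.mem_setOf_eq]; exact ⟨fun h => h.2, fun h => ⟨hp, h⟩⟩
      rw [hGeq]
      have h2 := hA2' F hFdeep z hzF p.1 p.2 hp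
      have h1 := hA1 n 2 x hx.le F ⟨z, hzF⟩ hconn
      have hfP : q ^ K / x ^ 8 ≤ familyPartition n 2 F x := by
        rw [div_le_iff₀ (by positivity), hqdef, mul_pow, ← pow_mul, ← hcard]
        have e8 : x ^ (4 * 2) = x ^ 8 := by norm_num
        have e8' : x ^ (4 * 2 * F.card) = x ^ (8 * F.card) := by norm_num
        rw [e8, e8'] at h1
        linarith
      have hqK : 0 < q ^ K / x ^ 8 := by positivity
      have h3 := le_of_mul_ofReal_le hqK hfP hC₇.le h2
      have h4 : C₇ / (q ^ K / x ^ 8) = C₇ * x ^ 8 / q ^ K := by field_simp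
      rwa [h4] at h3
  -- Step 3: the union bound
  have hunion : W (⋃ z ∈ deepBoxes δ (n + 2), ⋃ K ∈ Finset.Ico K₀ K₁, ⋃ F ∈ famAt δ (n + 2) z K,
        ⋃ p : Fin 2 × Bool, G F z p) ≤
      ∑ z ∈ deepBoxes δ (n + 2), ∑ K ∈ Finset.Ico K₀ K₁, ∑ F ∈ famAt δ (n + 2) z K,
        ∑ p : Fin 2 × Bool, W (G F z p) := by
    refine (measure_biUnion_finset_le _ _).trans (Finset.sum_le_sum fun z _ => ?_)
    refine (measure_biUnion_finset_le _ _).trans (Finset.sum_le_sum fun K _ => ?_)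
    refine (measure_biUnion_finset_le _ _).trans (Finset.sum_le_sum fun F _ => ?_)
    exact measure_iUnion_fintype_le _ _
  have hsum : ∑ z ∈ deepBoxes δ (n + 2), ∑ K ∈ Finset.Ico K₀ K₁, ∑ F ∈ famAt δ (n + 2) z K,
        ∑ p : Fin 2 × Bool, W (G F z p) ≤
      ∑ z ∈ deepBoxes δ (n + 2), ∑ K ∈ Finset.Ico K₀ K₁,
        ENNReal.ofReal ((25 : ℝ) ^ (K - 1) * 4 * (C₇ * x ^ 8 / q ^ K)) * W Set.univ := by
    refine Finset.sum_le_sum fun z hz => Finset.sum_le_sum fun K hK => ?_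
    calc ∑ F ∈ famAt δ (n + 2) z K, ∑ p : Fin 2 × Bool, W (G F z p)
        ≤ ∑ F ∈ famAt δ (n + 2) z K, ∑ _p : Fin 2 × Bool,
            ENNReal.ofReal (C₇ * x ^ 8 / q ^ K) * W Set.univ :=
          Finset.sum_le_sum fun F hF => Finset.sum_le_sum fun p _ => hterm z hz K hK F hF p
      _ = ((famAt δ (n + 2) z K).card : ℝ≥0∞) * (4 * (ENNReal.ofReal (C₇ * x ^ 8 / q ^ K) * W Set.univ)) := by
          rw [Finset.sum_const, Finset.sum_const, Finset.card_univ, nsmul_eq_mul, nsmul_eq_mul]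
          norm_num
      _ ≤ ((25 ^ (K - 1) : ℕ) : ℝ≥0∞) * (4 * (ENNReal.ofReal (C₇ * x ^ 8 / q ^ K) * W Set.univ)) := by
          gcongr; exact_mod_cast card_famAt_le (δ := δ) (n + 2) z K
      _ = ENNReal.ofReal ((25 : ℝ) ^ (K - 1) * 4 * (C₇ * x ^ 8 / q ^ K)) * W Set.univ := by
          rw [ENNReal.ofReal_mul (by positivity), ENNReal.ofReal_mul (by positivity)]
          have : ((25 ^ (K - 1) : ℕ) : ℝ≥0∞) = ENNReal.ofReal ((25 : ℝ) ^ (K - 1)) := by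
            rw [ENNReal.ofReal_pow (by norm_num)]; norm_num
          rw [this, show (4 : ℝ≥0∞) = ENNReal.ofReal 4 by norm_num]
          ring
  have hreal : ∑ z ∈ deepBoxes δ (n + 2), ∑ K ∈ Finset.Ico K₀ K₁,
        ENNReal.ofReal ((25 : ℝ) ^ (K - 1) * 4 * (C₇ * x ^ 8 / q ^ K)) * W Set.univ ≤
      ENNReal.ofReal (8 * C₇ * x ^ 8 / δ ^ 2 * Real.exp (-(Real.log 2 / C₃ * s))) * W Set.univ := by
    rw [Finset.sum_const, nsmul_eq_mul, ← Finset.sum_mul, ← mul_assoc,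
      ← ENNReal.ofReal_sum_of_nonneg (fun K _ => by positivity)]
    gcongr
    rw [show ((deepBoxes δ (n + 2)).card : ℝ≥0∞) = ENNReal.ofReal ((deepBoxes δ (n + 2)).card : ℝ) by
      rw [ENNReal.ofReal_natCast], ← ENNReal.ofReal_mul (by positivity)]
    refine ENNReal.ofReal_le_ofReal ?_
    have htail := peierls_tail_le (x := x) s C₃ hq hC₇.le K₁
    have hcard := card_deepBoxes_le hδ hδ1 (n + 2)
    calc ((deepBoxes δ (n + 2)).card : ℝ) *
          ∑ K ∈ Finset.Ico K₀ K₁, (25 : ℝ) ^ (K - 1) * 4 * (C₇ * x ^ 8 / q ^ K)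
        ≤ 25 / δ ^ 2 * (8 * C₇ * x ^ 8 / 25 * Real.exp (-(Real.log 2 / C₃ * s))) :=
          mul_le_mul hcard htail (Finset.sum_nonneg fun K _ => by positivity) (by positivity)
      _ = 8 * C₇ * x ^ 8 / δ ^ 2 * Real.exp (-(Real.log 2 / C₃ * s)) := by
          field_simp
  calc W {γ | HasLargeHole (tubeRadius (n + 2)) s γ}
      ≤ W (BAD ∪ ⋃ z ∈ deepBoxes δ (n + 2), ⋃ K ∈ Finset.Ico K₀ K₁, ⋃ F ∈ famAt δ (n + 2) z K,
          ⋃ p : Fin 2 × Bool, G F z p) := measure_mono hincl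
    _ ≤ W BAD + W (⋃ z ∈ deepBoxes δ (n + 2), ⋃ K ∈ Finset.Ico K₀ K₁, ⋃ F ∈ famAt δ (n + 2) z K,
          ⋃ p : Fin 2 × Bool, G F z p) := measure_union_le _ _
    _ ≤ W BAD + ENNReal.ofReal (8 * C₇ * x ^ 8 / δ ^ 2 * Real.exp (-(Real.log 2 / C₃ * s))) *
          W Set.univ := by
        gcongr
        exact hunion.trans (hsum.trans hreal)


/-- **Theorem 6 of Duminil-Copin–Kozma–Yadin 2014 for the unit disk along the printed `m`-box
route (conditional reduction)**: Proposition 3 (`Z_m(x)` unbounded for `x > 1/μ`, upstream named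
fact of `SupercriticalSAWPolygons.lean`), the Claim in the moat form of
`SupercriticalSAWSpaceFillingBoxes.lean`, the energy–entropy bound `hA2` of Proposition 7 for the
disk and the boundary-layer estimate `hC` imply `DKY2014_thm6_disk`, with `ξ(x) = ξ(m(x))`
(`tubeRadius`), `m(x) = n(x) + 2` where
`x⁸ Z_{n(x)}(x) ≥ 100` and `Z_{n(x)}(x) ≥ T(x)` ("apply Proposition 3 and get some `m = m(x,2)`
such that `Z_m(x) > 2λ`", here `λ = 25`, the moat costing `x⁸` per box),
`c(x) = min(log 2/(7N)², c_B/25)` and `δ₀(x,a,b) = min(δ_B(a,b), 1/4, 1/(3N)²)`.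

The hypothesis `hA2` is Proposition 7 of the source for `Ω = 𝔻` over the boxes with moat `g = 2`
("there exists `C(x,m) < ∞` such that for every `F ∈ 𝓕(Ω_δ,m)`,
`P_{(Ω_δ,a_δ,b_δ,x)}(bdist(γ_δ, V_F) = 1) ≤ C(x,m) Z_m(x)^{-|F|}`", in the multiplicative form
`Z_{Θ_F}(x) · Z_F(x) ≤ C · Z_{(Ω_δ,a_δ,b_δ)}(x)` of its printed proof, per touched neighbouring
box): for every inner size `n` and `x > 0` a constant `C₇` such that, for every mesh, endpoints
near the outside of `𝔻_δ`, every family `F` of deep boxes and every box `B(z₀ + d) ∉ F` adjacent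
to `z₀ ∈ F`, the weight of the walks avoiding the boxes of `F` and meeting `B(z₀ + d)` times
`Z_{S_F}(x)` is at most `C₇` times the partition function. It is an explicit hypothesis rather
than a named fact: its printed proof rests on the existence of the link polygon `ℓ(γ)` ("One can
easily check that such a polygon always exists"), which the tree establishes in tile form only
(`mainEvent_bound`, `SupercriticalSAWSpaceFillingTilesSurgery.lean`).
The hypothesis `hC` is the case of the printed proof that the print does not treat ("the
box-distance between the union of boxes and `γ_δ` is 1" presumes that `γ_δ` meets an `m`-box):
for the box parameter `n` (moat `2`) with `Z_n(x) ≥ T(x)`, the walks from `a_δ` to `b_δ` meeting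
NO deep `(n+2)`-box of `𝔻_δ` weigh at most `C e^{-c/δ²}` times the partition function once
`δ < δ_B(a, b)`. It is not a statement of the source and is therefore an explicit hypothesis
here rather than a named fact; the tile form of the proof establishes this case in its own
geometry (`annEvent_bound`), and the unconditional theorem is `DKY2014_thm6_disk_holds`
(`SupercriticalSAWSpaceFillingTilesTheorem6.lean`).
[cite: DuminilCopinKozmaYadin2014, Theorem 6, Proposition 7 and §3 (proof of Theorem 6)] -/
theorem DKY2014_thm6_disk_of_facts (h3 : DKY2014_prop3) (hA1 : DKY2014_prop7_claim)
    (hA2 : ∀ (n : ℕ) (x : ℝ), 0 < x → ∃ C : ℝ, 0 < C ∧ ∀ δ : ℝ, 0 < δ →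
      ∀ u v : Site 2, NearOutside δ u → NearOutside δ v →
      ∀ F ⊆ deepBoxes δ (n + 2), ∀ z₀ ∈ F, ∀ (i : Fin 2) (b : Bool), z₀ + dirVec i b ∉ F →
        weightAt x unitDisk δ u v
            {γ | (∀ w ∈ γ.walk.support, w ∉ boxVertices (n + 2) F) ∧
              ∃ w ∈ γ.walk.support, w ∈ mBox (n + 2) (z₀ + dirVec i b)} *
          ENNReal.ofReal (familyPartition n 2 F x) ≤
        ENNReal.ofReal C * weightAt x unitDisk δ u v Set.univ)
    (hC : ∀ x : ℝ, 0 < x → ∃ T : ℝ, ∀ n : ℕ, T ≤ Zbox n x → ∃ c : ℝ, 0 < c ∧ ∃ C : ℝ,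
      ∀ a b : ℂ, ‖a‖ = 1 → ‖b‖ = 1 → a ≠ b → ∃ δ₁ : ℝ, 0 < δ₁ ∧ ∀ δ : ℝ, 0 < δ → δ < δ₁ →
        ∀ u v : Site 2, IsClosestSite unitDisk δ a u → IsClosestSite unitDisk δ b v →
          weightAt x unitDisk δ u v
              {γ | ∀ z ∈ deepBoxes δ (n + 2), ∀ w ∈ γ.walk.support, w ∉ mBox (n + 2) z} ≤
            ENNReal.ofReal (C * Real.exp (-(c / δ ^ 2))) * weightAt x unitDisk δ u v Set.univ) :
    DKY2014_thm6_disk := by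
  intro x hx
  have hx0 : 0 < x := criticalFugacity_nonneg.trans_lt hx
  obtain ⟨T, hT⟩ := hC x hx0
  -- the box size: `x⁸ Z_n(x) ≥ 100` and `Z_n(x) ≥ T`
  obtain ⟨n, hn⟩ : ∃ n : ℕ, max (100 / x ^ 8) T ≤ Zbox n x := (h3 x hx (max (100 / x ^ 8) T)).exists
  have hn100 : 100 / x ^ 8 ≤ Zbox n x := (le_max_left _ _).trans hn
  have hnT : T ≤ Zbox n x := (le_max_right _ _).trans hn
  set q : ℝ := x ^ 8 * Zbox n x with hqdef
  have hq : 100 ≤ q := by rw [hqdef]; rwa [div_le_iff₀' (by positivity)] at hn100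
  obtain ⟨C₇, hC₇, hA2'⟩ := hA2 n x hx0
  obtain ⟨cB, hcB, CB, hC'⟩ := hT n hnT
  set N : ℝ := 2 * ((n + 2 : ℕ) : ℝ) + 2 with hN
  have hN0 : 0 < N := by positivity
  set C₃ : ℝ := (7 * N) ^ 2 with hC₃
  have hC₃0 : 0 < C₃ := by positivity
  have hξ : (0 : ℝ) < tubeRadius (n + 2) := by
    have : 0 < tubeRadius (n + 2) := by unfold tubeRadius; omega
    exact_mod_cast this
  refine ⟨tubeRadius (n + 2), hξ, min (Real.log 2 / C₃) (cB / 25),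
    lt_min (div_pos (Real.log_pos one_lt_two) hC₃0) (by positivity),
    (8 * C₇ * x ^ 8 + max CB 0), fun a b ha hb hab => ?_⟩
  obtain ⟨δ₁, hδ₁, hC''⟩ := hC' a b ha hb hab
  refine ⟨min (min δ₁ (1 / 4)) (1 / (3 * N) ^ 2), by positivity, ?_⟩
  intro δ hδ hδ₀ u v hu hv s hs
  -- unpack the smallness of `δ`
  have hδδ₁ : δ < δ₁ := hδ₀.trans_le ((min_le_left _ _).trans (min_le_left _ _))
  have hδ4 : δ ≤ 1 / 4 := hδ₀.le.trans ((min_le_left _ _).trans (min_le_right _ _))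
  have hδN : δ ≤ 1 / (3 * N) ^ 2 := hδ₀.le.trans (min_le_right _ _)
  have hδ1 : δ ≤ 1 := by linarith
  have hδN' : δ ≤ 1 / (3 * (2 * ((n + 2 : ℕ) : ℝ) + 2)) ^ 2 := by rw [hN] at hδN; exact hδN
  -- the endpoints
  have huN := nearOutside_of_isClosestSite hδ hδ4 ha hu
  have hvN := nearOutside_of_isClosestSite hδ hδ4 hb hv
  -- the two estimates
  have hcore := weightAt_hasLargeHole_le hA1 hx0 hq hqdef hC₇
    (fun F hF z₀ hz₀ i b' hnot => hA2' δ hδ u v huN hvN F hF z₀ hz₀ i b' hnot) hδ hδ1 hδN' hs.le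
  have hbad := hC'' δ hδ hδδ₁ u v hu hv
  apply lawAt_le_of_weightAt_le
  -- an empty event needs no estimate; otherwise `s < 25/δ²`
  rcases Set.eq_empty_or_nonempty
      {γ : DomainSAW unitDisk δ u v | HasLargeHole (tubeRadius (n + 2)) s γ} with hE | ⟨γ, hγ⟩
  · rw [hE, measure_empty]; exact zero_le
  have hs25 : s < 25 / δ ^ 2 := by
    have h1 := lt_of_hasLargeHole hδ hγ
    have h2 := ceil_sq_le hδ hδ1
    push_cast at h1 h2
    exact h1.trans_le h2
  have hfin := final_constant_le (cG := Real.log 2 / C₃) (CB := CB) (A := 8 * C₇ * x ^ 8) hδ hδ1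
    hs.le hs25 hcB (by positivity)
  have hbad' : weightAt x unitDisk δ u v
        {γ | ∀ z ∈ deepBoxes δ (n + 2), ∀ w ∈ γ.walk.support, w ∉ mBox (n + 2) z} ≤
      ENNReal.ofReal (max (CB * Real.exp (-(cB / δ ^ 2))) 0) * weightAt x unitDisk δ u v Set.univ :=
    hbad.trans (mul_le_mul_of_nonneg_right (ENNReal.ofReal_le_ofReal (le_max_left _ _)) zero_le)
  refine hcore.trans ((add_le_add hbad' le_rfl).trans ?_)
  rw [← add_mul, ← ENNReal.ofReal_add (le_max_right _ _) (by positivity)]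
  exact mul_le_mul_of_nonneg_right (ENNReal.ofReal_le_ofReal hfin) zero_le

end SupercriticalSAW

end Literature.Barriers.CriticalPhenomena
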